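import Mathlib
import HarnessLib
import Summits.HubbardSuperconductivity.HubbardSuperconductivity.Theorems.KLProgrammePerturbedFermiCurveTwoFrameTower4
import Summits.HubbardSuperconductivity.HubbardSuperconductivity.Theorems.KLProgrammePerturbedFermiCurveCompChainStruct

/-!
# Route `KLProgramme` — the COMPOSITE DIFFERENCE `F ∘ γ′ − F ∘ γ` to order four: one `C⁴` symbol read along two `C⁴` curves
# (structured chain rule, term-by-term differences; the slot-`m` part of the (E3a-MS) witness, analytic core)

Cell `gate-hubbard-kl`, seat hubbard-kl-k3c3-p3 (g3; row «implicit-function / monotonicity route»).  For the gen-5 ENGINE child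
(stmt-HubbardSuperconductivity-19918), stub `stub_twoLeg_step`, clause (E3a-MS) `TwoLegSizesMST`, recipe of record (L)+(F) (k3c3-p1
MS-DESIGN-NOTE §3; GEN5-AUDIT-ANNEX T-ms): every slot-`m` part is `klFrameExtFn μ (F ∘ γ′ − F ∘ γ)` for ONE increment interpolant `F`
(momentum sizes `‖DᵏF‖ ≤ M_k`) read along the curves `γ, γ′` of two nearby frames; k3c3-p1's symbol bound is linear in the angular sizes
of the profile, so what is needed is `|∂ʲ(F∘γ′)(θ) − ∂ʲ(F∘γ)(θ)|`, `j ≤ 4`, LINEAR in the two kinds of smallness: the curve-tower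
differences `‖γ′⁽ⁱ⁾(θ) − γ⁽ⁱ⁾(θ)‖ ≤ dD_i` (`…TwoFrameCurve`, `…TwoFrameBand(34)`) and the symbol differences at the two curve points
`‖DᵏF(γ′θ) − DᵏF(γθ)‖ ≤ Φ_k` (`≤ M_{k+1}·‖γ′θ − γθ‖` by the mean-value inequality, §2 — order four thus needs `M₅`, the (O1) moment).

* §1 `abs_iteratedDeriv_{one,two,three,four}_comp_sub_le` (any real normed space `V`, `F : V → ℝ`, `γ, γ′ : ℝ → V`, all `C⁴`): the
  order-`j` chain expressions of `…CompChain` (p483894) subtracted term by term with `abs_apply{1..4}_sub_le'` (p491085); e.g.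
  `|∂⁴(F∘γ′) − ∂⁴(F∘γ)| ≤ Φ₄D₁⁴ + 4M₄dD₁D₁³ + 6(Φ₃D₁²D₂ + M₃(dD₂D₁² + 2D₁D₂dD₁)) + 3(Φ₂D₂² + 2M₂D₂dD₂) + 4(Φ₂D₁D₃ + M₂(dD₁D₃ + D₁dD₃)) + Φ₁D₄ + M₁dD₄`.
* §2 `norm_fderiv{_,_two,_three,_four}_sub_le_of_global`: `Φ_k ≤ M_{k+1}·‖γ′θ − γθ‖` from a GLOBAL bound `‖D^{k+1}F‖ ≤ M_{k+1}` (`F ∈ C⁵`).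

Everything is PROVED; no definitions; carrier-free; nothing about the Hubbard model.  References: Faà di Bruno [folklore];
BGM 2006 §2.4 (2.36)/(2.40) [cite: BenfattoGiulianiMastropietro2006].
-/

noncomputable section

namespace Summit.HubbardSuperconductivity.HubbardSuperconductivity.Theorems.PerturbedFermiCurve

set_option linter.dupNamespace false -- summit = problem name (single-conjunct summit), D-0017
set_option maxSynthPendingDepth 4 -- nested operator-norm instances (up to fifth Fréchet derivatives)

open Real Set

/-! ## §1 Term-by-term differences of the chain expressions -/

section Diff

variable {V : Type*} [NormedAddCommGroup V] [NormedSpace ℝ V] {F : V → ℝ} {γ γ' : ℝ → V}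
  (hF : ContDiff ℝ 4 F) (hγ : ContDiff ℝ 4 γ) (hγ' : ContDiff ℝ 4 γ')
  {θ M₁ M₂ M₃ M₄ Φ₁ Φ₂ Φ₃ Φ₄ D₁ D₂ D₃ D₄ dD₁ dD₂ dD₃ dD₄ : ℝ}
  (hM₁ : ‖fderiv ℝ F (γ θ)‖ ≤ M₁) (hM₂ : ‖fderiv ℝ (fderiv ℝ F) (γ θ)‖ ≤ M₂)
  (hM₃ : ‖fderiv ℝ (fderiv ℝ (fderiv ℝ F)) (γ θ)‖ ≤ M₃) (hM₄ : ‖fderiv ℝ (fderiv ℝ (fderiv ℝ (fderiv ℝ F))) (γ θ)‖ ≤ M₄)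
  (hΦ₁ : ‖fderiv ℝ F (γ' θ) - fderiv ℝ F (γ θ)‖ ≤ Φ₁)
  (hΦ₂ : ‖fderiv ℝ (fderiv ℝ F) (γ' θ) - fderiv ℝ (fderiv ℝ F) (γ θ)‖ ≤ Φ₂)
  (hΦ₃ : ‖fderiv ℝ (fderiv ℝ (fderiv ℝ F)) (γ' θ) - fderiv ℝ (fderiv ℝ (fderiv ℝ F)) (γ θ)‖ ≤ Φ₃)
  (hΦ₄ : ‖fderiv ℝ (fderiv ℝ (fderiv ℝ (fderiv ℝ F))) (γ' θ) - fderiv ℝ (fderiv ℝ (fderiv ℝ (fderiv ℝ F))) (γ θ)‖ ≤ Φ₄)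
  (hD₁ : ‖iteratedDeriv 1 γ θ‖ ≤ D₁) (hD₁' : ‖iteratedDeriv 1 γ' θ‖ ≤ D₁) (hD₂ : ‖iteratedDeriv 2 γ θ‖ ≤ D₂)
  (hD₂' : ‖iteratedDeriv 2 γ' θ‖ ≤ D₂) (hD₃ : ‖iteratedDeriv 3 γ θ‖ ≤ D₃) (hD₃' : ‖iteratedDeriv 3 γ' θ‖ ≤ D₃)
  (hD₄' : ‖iteratedDeriv 4 γ' θ‖ ≤ D₄)
  (hdD₁ : ‖iteratedDeriv 1 γ' θ - iteratedDeriv 1 γ θ‖ ≤ dD₁) (hdD₂ : ‖iteratedDeriv 2 γ' θ - iteratedDeriv 2 γ θ‖ ≤ dD₂)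
  (hdD₃ : ‖iteratedDeriv 3 γ' θ - iteratedDeriv 3 γ θ‖ ≤ dD₃) (hdD₄ : ‖iteratedDeriv 4 γ' θ - iteratedDeriv 4 γ θ‖ ≤ dD₄)
include hF hγ hγ'

section One
include hM₁ hΦ₁ hD₁' hdD₁

/-- **Order 1**: `|∂(F∘γ′)(θ) − ∂(F∘γ)(θ)| ≤ Φ₁·D₁ + M₁·dD₁`. [folklore] -/
theorem abs_iteratedDeriv_one_comp_sub_le : |iteratedDeriv 1 (F ∘ γ') θ - iteratedDeriv 1 (F ∘ γ) θ| ≤ Φ₁ * D₁ + M₁ * dD₁ := by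
  rw [iteratedDeriv_one_comp_eq hF hγ' θ, iteratedDeriv_one_comp_eq hF hγ θ]
  exact abs_apply_sub_le' hΦ₁ hM₁ hD₁' hdD₁

end One

section Two
include hM₁ hM₂ hΦ₁ hΦ₂ hD₁ hD₁' hD₂' hdD₁ hdD₂

/-- **Order 2**: `|∂²(F∘γ′) − ∂²(F∘γ)| ≤ Φ₂D₁² + M₂(dD₁D₁ + D₁dD₁) + Φ₁D₂ + M₁dD₂`. [folklore] -/
theorem abs_iteratedDeriv_two_comp_sub_le :
    |iteratedDeriv 2 (F ∘ γ') θ - iteratedDeriv 2 (F ∘ γ) θ| ≤ Φ₂ * D₁ ^ 2 + 2 * M₂ * D₁ * dD₁ + Φ₁ * D₂ + M₁ * dD₂ := by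
  rw [iteratedDeriv_two_comp_eq hF hγ' θ, iteratedDeriv_two_comp_eq hF hγ θ]
  have t2 := abs_apply₂_sub_le' hΦ₂ hM₂ hD₁ hD₁' hD₁' hdD₁ hdD₁
  have t1 := abs_apply_sub_le' hΦ₁ hM₁ hD₂' hdD₂
  have e : fderiv ℝ (fderiv ℝ F) (γ' θ) (iteratedDeriv 1 γ' θ) (iteratedDeriv 1 γ' θ) + fderiv ℝ F (γ' θ) (iteratedDeriv 2 γ' θ) -
      (fderiv ℝ (fderiv ℝ F) (γ θ) (iteratedDeriv 1 γ θ) (iteratedDeriv 1 γ θ) + fderiv ℝ F (γ θ) (iteratedDeriv 2 γ θ)) =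
      (fderiv ℝ (fderiv ℝ F) (γ' θ) (iteratedDeriv 1 γ' θ) (iteratedDeriv 1 γ' θ) -
        fderiv ℝ (fderiv ℝ F) (γ θ) (iteratedDeriv 1 γ θ) (iteratedDeriv 1 γ θ)) +
        (fderiv ℝ F (γ' θ) (iteratedDeriv 2 γ' θ) - fderiv ℝ F (γ θ) (iteratedDeriv 2 γ θ)) := by ring
  rw [e]
  exact (abs_add_le_add t2 t1).trans (le_of_eq (by ring))

end Two

section Three
include hM₁ hM₂ hM₃ hΦ₁ hΦ₂ hΦ₃ hD₁ hD₁' hD₂ hD₂' hD₃' hdD₁ hdD₂ hdD₃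

/-- **Order 3**: `|∂³(F∘γ′) − ∂³(F∘γ)| ≤ Φ₃D₁³ + 3M₃dD₁D₁² + 3(Φ₂D₁D₂ + M₂(dD₁D₂ + D₁dD₂)) + Φ₁D₃ + M₁dD₃`. [folklore] -/
theorem abs_iteratedDeriv_three_comp_sub_le :
    |iteratedDeriv 3 (F ∘ γ') θ - iteratedDeriv 3 (F ∘ γ) θ| ≤
      Φ₃ * D₁ ^ 3 + 3 * M₃ * dD₁ * D₁ ^ 2 + 3 * (Φ₂ * D₁ * D₂ + M₂ * (dD₁ * D₂ + D₁ * dD₂)) + Φ₁ * D₃ + M₁ * dD₃ := by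
  rw [iteratedDeriv_three_comp_eq hF hγ' θ, iteratedDeriv_three_comp_eq hF hγ θ]
  set A₁ := fderiv ℝ F (γ θ); set Ã₁ := fderiv ℝ F (γ' θ)
  set A₂ := fderiv ℝ (fderiv ℝ F) (γ θ); set Ã₂ := fderiv ℝ (fderiv ℝ F) (γ' θ)
  set A₃ := fderiv ℝ (fderiv ℝ (fderiv ℝ F)) (γ θ); set Ã₃ := fderiv ℝ (fderiv ℝ (fderiv ℝ F)) (γ' θ)
  set v₁ := iteratedDeriv 1 γ θ; set v₂ := iteratedDeriv 2 γ θ; set v₃ := iteratedDeriv 3 γ θ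
  set w₁ := iteratedDeriv 1 γ' θ; set w₂ := iteratedDeriv 2 γ' θ; set w₃ := iteratedDeriv 3 γ' θ
  clear_value A₁ Ã₁ A₂ Ã₂ A₃ Ã₃ v₁ v₂ v₃ w₁ w₂ w₃
  have t3 := abs_apply₃_sub_le' hΦ₃ hM₃ hD₁ hD₁' hD₁ hD₁' hD₁' hdD₁ hdD₁ hdD₁
  have t21 := abs_apply₂_sub_le' hΦ₂ hM₂ hD₂ hD₂' hD₁' hdD₂ hdD₁
  have t12 := abs_apply₂_sub_le' hΦ₂ hM₂ hD₁ hD₁' hD₂' hdD₁ hdD₂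
  have t1 := abs_apply_sub_le' hΦ₁ hM₁ hD₃' hdD₃
  have e : Ã₃ w₁ w₁ w₁ + Ã₂ w₂ w₁ + Ã₂ w₁ w₂ + (Ã₂ w₁ w₂ + Ã₁ w₃) - (A₃ v₁ v₁ v₁ + A₂ v₂ v₁ + A₂ v₁ v₂ + (A₂ v₁ v₂ + A₁ v₃)) =
      (Ã₃ w₁ w₁ w₁ - A₃ v₁ v₁ v₁) + (Ã₂ w₂ w₁ - A₂ v₂ v₁) + (Ã₂ w₁ w₂ - A₂ v₁ v₂) + ((Ã₂ w₁ w₂ - A₂ v₁ v₂) + (Ã₁ w₃ - A₁ v₃)) := by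
    ring
  rw [e]
  exact (abs_add_le_add (abs_add_le_add (abs_add_le_add t3 t21) t12) (abs_add_le_add t12 t1)).trans (le_of_eq (by ring))

end Three

section Four
include hM₁ hM₂ hM₃ hM₄ hΦ₁ hΦ₂ hΦ₃ hΦ₄ hD₁ hD₁' hD₂ hD₂' hD₃ hD₃' hD₄' hdD₁ hdD₂ hdD₃ hdD₄

/-- **Order 4**: `|∂⁴(F∘γ′) − ∂⁴(F∘γ)| ≤ Φ₄D₁⁴ + 4M₄dD₁D₁³ + 6(Φ₃D₁²D₂ + M₃(dD₂D₁² + 2D₁D₂dD₁)) + 3(Φ₂D₂² + 2M₂D₂dD₂) +`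
`4(Φ₂D₁D₃ + M₂(dD₁D₃ + D₁dD₃)) + Φ₁D₄ + M₁dD₄`. [folklore] -/
theorem abs_iteratedDeriv_four_comp_sub_le :
    |iteratedDeriv 4 (F ∘ γ') θ - iteratedDeriv 4 (F ∘ γ) θ| ≤
      Φ₄ * D₁ ^ 4 + 4 * M₄ * dD₁ * D₁ ^ 3 + 6 * (Φ₃ * D₁ ^ 2 * D₂ + M₃ * (dD₂ * D₁ ^ 2 + 2 * D₁ * D₂ * dD₁)) +
        3 * (Φ₂ * D₂ ^ 2 + 2 * M₂ * D₂ * dD₂) + 4 * (Φ₂ * D₁ * D₃ + M₂ * (dD₁ * D₃ + D₁ * dD₃)) + Φ₁ * D₄ + M₁ * dD₄ := by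
  rw [iteratedDeriv_four_comp_eq hF hγ' θ, iteratedDeriv_four_comp_eq hF hγ θ]
  set A₁ := fderiv ℝ F (γ θ); set Ã₁ := fderiv ℝ F (γ' θ)
  set A₂ := fderiv ℝ (fderiv ℝ F) (γ θ); set Ã₂ := fderiv ℝ (fderiv ℝ F) (γ' θ)
  set A₃ := fderiv ℝ (fderiv ℝ (fderiv ℝ F)) (γ θ); set Ã₃ := fderiv ℝ (fderiv ℝ (fderiv ℝ F)) (γ' θ)
  set A₄ := fderiv ℝ (fderiv ℝ (fderiv ℝ (fderiv ℝ F))) (γ θ); set Ã₄ := fderiv ℝ (fderiv ℝ (fderiv ℝ (fderiv ℝ F))) (γ' θ)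
  set v₁ := iteratedDeriv 1 γ θ; set v₂ := iteratedDeriv 2 γ θ; set v₃ := iteratedDeriv 3 γ θ; set v₄ := iteratedDeriv 4 γ θ
  set w₁ := iteratedDeriv 1 γ' θ; set w₂ := iteratedDeriv 2 γ' θ; set w₃ := iteratedDeriv 3 γ' θ; set w₄ := iteratedDeriv 4 γ' θ
  clear_value A₁ Ã₁ A₂ Ã₂ A₃ Ã₃ A₄ Ã₄ v₁ v₂ v₃ v₄ w₁ w₂ w₃ w₄
  have t4 := abs_apply₄_sub_le' hΦ₄ hM₄ hD₁ hD₁' hdD₁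
  have t3a := abs_apply₃_sub_le' hΦ₃ hM₃ hD₂ hD₂' hD₁ hD₁' hD₁' hdD₂ hdD₁ hdD₁
  have t3b := abs_apply₃_sub_le' hΦ₃ hM₃ hD₁ hD₁' hD₂ hD₂' hD₁' hdD₁ hdD₂ hdD₁
  have t3c := abs_apply₃_sub_le' hΦ₃ hM₃ hD₁ hD₁' hD₁ hD₁' hD₂' hdD₁ hdD₁ hdD₂
  have t31 := abs_apply₂_sub_le' hΦ₂ hM₂ hD₃ hD₃' hD₁' hdD₃ hdD₁
  have t13 := abs_apply₂_sub_le' hΦ₂ hM₂ hD₁ hD₁' hD₃' hdD₁ hdD₃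
  have t22 := abs_apply₂_sub_le' hΦ₂ hM₂ hD₂ hD₂' hD₂' hdD₂ hdD₂
  have t1 := abs_apply_sub_le' hΦ₁ hM₁ hD₄' hdD₄
  have e : Ã₄ w₁ w₁ w₁ w₁ + Ã₃ w₂ w₁ w₁ + Ã₃ w₁ w₂ w₁ + Ã₃ w₁ w₁ w₂ + (Ã₃ w₁ w₂ w₁ + Ã₂ w₃ w₁ + Ã₂ w₂ w₂) +
        (Ã₃ w₁ w₁ w₂ + Ã₂ w₂ w₂ + Ã₂ w₁ w₃) + (Ã₃ w₁ w₁ w₂ + Ã₂ w₂ w₂ + Ã₂ w₁ w₃) + (Ã₂ w₁ w₃ + Ã₁ w₄) -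
      (A₄ v₁ v₁ v₁ v₁ + A₃ v₂ v₁ v₁ + A₃ v₁ v₂ v₁ + A₃ v₁ v₁ v₂ + (A₃ v₁ v₂ v₁ + A₂ v₃ v₁ + A₂ v₂ v₂) +
        (A₃ v₁ v₁ v₂ + A₂ v₂ v₂ + A₂ v₁ v₃) + (A₃ v₁ v₁ v₂ + A₂ v₂ v₂ + A₂ v₁ v₃) + (A₂ v₁ v₃ + A₁ v₄)) =
      (Ã₄ w₁ w₁ w₁ w₁ - A₄ v₁ v₁ v₁ v₁) + (Ã₃ w₂ w₁ w₁ - A₃ v₂ v₁ v₁) + (Ã₃ w₁ w₂ w₁ - A₃ v₁ v₂ v₁) +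
        (Ã₃ w₁ w₁ w₂ - A₃ v₁ v₁ v₂) +
        ((Ã₃ w₁ w₂ w₁ - A₃ v₁ v₂ v₁) + (Ã₂ w₃ w₁ - A₂ v₃ v₁) + (Ã₂ w₂ w₂ - A₂ v₂ v₂)) +
        ((Ã₃ w₁ w₁ w₂ - A₃ v₁ v₁ v₂) + (Ã₂ w₂ w₂ - A₂ v₂ v₂) + (Ã₂ w₁ w₃ - A₂ v₁ v₃)) +
        ((Ã₃ w₁ w₁ w₂ - A₃ v₁ v₁ v₂) + (Ã₂ w₂ w₂ - A₂ v₂ v₂) + (Ã₂ w₁ w₃ - A₂ v₁ v₃)) +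
        ((Ã₂ w₁ w₃ - A₂ v₁ v₃) + (Ã₁ w₄ - A₁ v₄)) := by ring
  rw [e]
  have hT := abs_add_le_add
    (abs_add_le_add
      (abs_add_le_add
        (abs_add_le_add
          (abs_add_le_add (abs_add_le_add (abs_add_le_add t4 t3a) t3b) t3c)
          (abs_add_le_add (abs_add_le_add t3b t31) t22))
        (abs_add_le_add (abs_add_le_add t3c t22) t13))
      (abs_add_le_add (abs_add_le_add t3c t22) t13))
    (abs_add_le_add t13 t1)
  exact hT.trans (le_of_eq (by ring))

end Four

end Diff

/-! ## §2 The symbol differences from GLOBAL bounds on the next derivative (mean value) -/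

section Global

variable {V : Type*} [NormedAddCommGroup V] [NormedSpace ℝ V] {F : V → ℝ} (hF : ContDiff ℝ 5 F)
include hF

/-- `‖DF(x) − DF(y)‖ ≤ M₂·‖x − y‖` from `‖D²F‖ ≤ M₂` everywhere. [folklore] -/
theorem norm_fderiv_sub_le_of_global {M₂ : ℝ} (hM₂ : ∀ z, ‖fderiv ℝ (fderiv ℝ F) z‖ ≤ M₂) (x y : V) :
    ‖fderiv ℝ F x - fderiv ℝ F y‖ ≤ M₂ * ‖x - y‖ :=
  (convex_univ).norm_image_sub_le_of_norm_fderiv_le (fun z _ => ((hF.fderiv_right (m := 4) (by norm_num)).differentiable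
    (by norm_num)) z) (fun z _ => hM₂ z) (mem_univ y) (mem_univ x)

/-- `‖D²F(x) − D²F(y)‖ ≤ M₃·‖x − y‖` from `‖D³F‖ ≤ M₃` everywhere. [folklore] -/
theorem norm_fderiv_two_sub_le_of_global {M₃ : ℝ} (hM₃ : ∀ z, ‖fderiv ℝ (fderiv ℝ (fderiv ℝ F)) z‖ ≤ M₃) (x y : V) :
    ‖fderiv ℝ (fderiv ℝ F) x - fderiv ℝ (fderiv ℝ F) y‖ ≤ M₃ * ‖x - y‖ :=
  (convex_univ).norm_image_sub_le_of_norm_fderiv_le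
    (fun z _ => (((hF.fderiv_right (m := 4) (by norm_num)).fderiv_right (m := 3) (by norm_num)).differentiable (by norm_num)) z)
    (fun z _ => hM₃ z) (mem_univ y) (mem_univ x)

/-- `‖D³F(x) − D³F(y)‖ ≤ M₄·‖x − y‖` from `‖D⁴F‖ ≤ M₄` everywhere. [folklore] -/
theorem norm_fderiv_three_sub_le_of_global {M₄ : ℝ} (hM₄ : ∀ z, ‖fderiv ℝ (fderiv ℝ (fderiv ℝ (fderiv ℝ F))) z‖ ≤ M₄) (x y : V) :
    ‖fderiv ℝ (fderiv ℝ (fderiv ℝ F)) x - fderiv ℝ (fderiv ℝ (fderiv ℝ F)) y‖ ≤ M₄ * ‖x - y‖ :=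
  (convex_univ).norm_image_sub_le_of_norm_fderiv_le
    (fun z _ => ((((hF.fderiv_right (m := 4) (by norm_num)).fderiv_right (m := 3) (by norm_num)).fderiv_right (m := 2)
      (by norm_num)).differentiable (by norm_num)) z) (fun z _ => hM₄ z) (mem_univ y) (mem_univ x)

/-- `‖D⁴F(x) − D⁴F(y)‖ ≤ M₅·‖x − y‖` from `‖D⁵F‖ ≤ M₅` everywhere (`F ∈ C⁵`: the (O1) moment at order four). [folklore] -/
theorem norm_fderiv_four_sub_le_of_global {M₅ : ℝ}
    (hM₅ : ∀ z, ‖fderiv ℝ (fderiv ℝ (fderiv ℝ (fderiv ℝ (fderiv ℝ F)))) z‖ ≤ M₅) (x y : V) :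
    ‖fderiv ℝ (fderiv ℝ (fderiv ℝ (fderiv ℝ F))) x - fderiv ℝ (fderiv ℝ (fderiv ℝ (fderiv ℝ F))) y‖ ≤ M₅ * ‖x - y‖ :=
  (convex_univ).norm_image_sub_le_of_norm_fderiv_le
    (fun z _ => (((((hF.fderiv_right (m := 4) (by norm_num)).fderiv_right (m := 3) (by norm_num)).fderiv_right (m := 2)
      (by norm_num)).fderiv_right (m := 1) (by norm_num)).differentiable one_ne_zero) z) (fun z _ => hM₅ z) (mem_univ y) (mem_univ x)

end Global

end Summit.HubbardSuperconductivity.HubbardSuperconductivity.Theorems.PerturbedFermiCurve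

end
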